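import Mathlib
import HarnessLib

/-!
# `RuledResidues.NonRuledDivisors` — line `automorphism-orbit`, stub 4 (engine B): a transcendental modulus kills periodicity

Registered stub `stub_modulusInjective` of `Cruxes/NonRuledDivisors/Lines/automorphism_orbit.lean`
(crux stmt-ResolutionOfSingularities-18075), proved verbatim.

Let `τ` be a ring automorphism of a field `K`, semilinear over an automorphism `ι` of a subfield `k`
(`τ (c·1) = (ι c)·1`), `W` a valuation subring of `K` containing `k`, `x ∈ K` with `τ x = x`, and `a ∈ k` with
`ιⁿ a ≠ a` for all `n ≥ 1`, such that `x − a·1` is a non-unit of `W`.  Then the orbit `n ↦ W.comap τⁿ` is injective: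
if `W.comap τᵐ = W.comap τⁿ` with `m < n` then `W = W.comap τᵈ` for `d = n − m ≥ 1`, so together with `x − a·1`
also `τᵈ (x − a·1) = x − (ιᵈ a)·1` is a non-unit of `W`; their difference `(ιᵈ a − a)·1` is then a non-unit, but it is
the image of a non-zero scalar, whose inverse lies in `W` — contradiction.
-/

set_option linter.dupNamespace false

namespace Summit.ResolutionOfSingularities.ResolutionOfSingularities.Theorems

/-- Engine B of line `automorphism-orbit` (crux `RuledResidues.NonRuledDivisors`): a `τ`-fixed element congruent
to a scalar of infinite `ι`-orbit modulo `𝔪_W` makes the orbit `n ↦ W.comap τⁿ` injective. [folklore] -/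
theorem stub_modulusInjective : ∀ (k K : Type) [Field k] [Field K] [Algebra k K] (τ : K ≃+* K) (ι : k ≃+* k), (∀ c : k, τ (algebraMap k K c) = algebraMap k K (ι c)) → ∀ W : ValuationSubring K, (∀ c : k, algebraMap k K c ∈ W) → ∀ (x : K) (a : k), τ x = x → (∀ n : ℕ, 0 < n → (ι ^ n) a ≠ a) → x - algebraMap k K a ∈ W.nonunits → Function.Injective (fun n : ℕ => W.comap ((τ ^ n : K ≃+* K) : K →+* K)) := by
  intro k K _ _ _ τ ι hsemi W hk x a hx ha hxa
  -- iterates of `τ` on `x` and on scalars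
  have hτx : ∀ n : ℕ, (τ ^ n) x = x := by
    intro n
    induction n with
    | zero => rfl
    | succ n ih =>
      show (τ ^ n) (τ x) = x
      rw [hx, ih]
  have hτc : ∀ (n : ℕ) (c : k), (τ ^ n) (algebraMap k K c) = algebraMap k K ((ι ^ n) c) := by
    intro n
    induction n with
    | zero => intro c; rfl
    | succ n ih =>
      intro c
      show (τ ^ n) (τ (algebraMap k K c)) = algebraMap k K ((ι ^ n) (ι c))
      rw [hsemi, ih]
  -- no member of the orbit with positive index equals `W`
  have hkey : ∀ d : ℕ, 0 < d → W.comap ((τ ^ d : K ≃+* K) : K →+* K) ≠ W := by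
    intro d hd heq
    have hmem : ∀ z : K, (τ ^ d) z ∈ W ↔ z ∈ W := by
      intro z
      have h1 : z ∈ W.comap ((τ ^ d : K ≃+* K) : K →+* K) ↔ ((τ ^ d : K ≃+* K) : K →+* K) z ∈ W :=
        ValuationSubring.mem_comap
      rw [heq] at h1
      exact h1.symm
    have hu' : x - algebraMap k K ((ι ^ d) a) ∈ W.nonunits := by
      rw [ValuationSubring.mem_nonunits_iff_or] at hxa ⊢
      rcases hxa with h0 | hinv
      · left
        have h2 : (τ ^ d) (x - algebraMap k K a) = 0 := by rw [h0, map_zero]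
        rwa [map_sub, hτx, hτc] at h2
      · right
        intro hmemW
        apply hinv
        rw [← hmem, map_inv₀, map_sub, hτx, hτc]
        exact hmemW
    have hdiff : algebraMap k K ((ι ^ d) a - a) ∈ W.nonunits := by
      have h3 := W.nonunits.sub_mem hu' hxa
      have e : x - algebraMap k K ((ι ^ d) a) - (x - algebraMap k K a) = -(algebraMap k K ((ι ^ d) a - a)) := by
        rw [map_sub]; ring
      rw [e] at h3
      simpa using W.nonunits.neg_mem h3
    have hne : (ι ^ d) a - a ≠ 0 := sub_ne_zero.mpr (ha d hd)
    rw [ValuationSubring.mem_nonunits_iff_or] at hdiff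
    rcases hdiff with h0 | hinv
    · exact hne ((algebraMap k K).injective (by rw [h0, map_zero]))
    · apply hinv
      rw [← map_inv₀]
      exact hk _
  -- two members with indices `m < n` differ
  have hlt : ∀ m n : ℕ, m < n →
      W.comap ((τ ^ m : K ≃+* K) : K →+* K) = W.comap ((τ ^ n : K ≃+* K) : K →+* K) → False := by
    intro m n hmn heq
    apply hkey (n - m) (Nat.sub_pos_of_lt hmn)
    ext z
    rw [ValuationSubring.mem_comap]
    have h := congrArg (fun A : ValuationSubring K => (τ ^ m).symm z ∈ A) heq
    simp only [ValuationSubring.mem_comap, eq_iff_iff] at h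
    have hpow : τ ^ n = τ ^ (n - m) * τ ^ m := (pow_sub_mul_pow τ hmn.le).symm
    have h2 : ((τ ^ n : K ≃+* K) : K →+* K) ((τ ^ m).symm z) = (τ ^ (n - m)) z := by
      rw [hpow]
      show (τ ^ (n - m)) ((τ ^ m) ((τ ^ m).symm z)) = _
      rw [RingEquiv.apply_symm_apply]
    have h3 : ((τ ^ m : K ≃+* K) : K →+* K) ((τ ^ m).symm z) = z := by
      show (τ ^ m) ((τ ^ m).symm z) = z
      rw [RingEquiv.apply_symm_apply]
    rw [h2, h3] at h
    exact h.symm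
  intro m n hmn
  rcases Nat.lt_trichotomy m n with h | h | h
  · exact (hlt m n h hmn).elim
  · exact h
  · exact (hlt n m h hmn.symm).elim

end Summit.ResolutionOfSingularities.ResolutionOfSingularities.Theorems
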